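import Summits.PneNP.PneNP.Theorems.KarlinRubinMonotoneBlindDepth3Rescue
import Summits.PneNP.PneNP.Theorems.KarlinRubinMonotoneBlindDnfBlind

/-!
# Route KarlinRubin, crux `MonotoneBlind` (stmt-PneNP-18027): depth 3 — the master inequality per `n`

For `f = ⋁_{i<m} g_i`, `g_i` the monotone CNF of `𝓒 i`, with `m ≤ n^c`, `#(𝓒 i) ≤ n^c` and the numeric hypotheses
`H1`–`H6` of the rescue lemma (`depth3_avg_H_le`): with `r = C(v₀-1,2)`, `m' = r+1`, `t = m' r`,
`Pr_{G(n,1/2,k)}[f] ≤ 2^t · Pr_{G(n,1/2)}[f] + (2^{t+1} + 3) · (n²)⁻¹`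
(`depth3_split_count` per planted set, averaged with `plantedCliqueDist_toOuterMeasure_eq_sum`, then the rescue
lemma for each of the `m ≤ n^c` CNFs). Seat write-up `MonotoneBlind_depth3_theorem.md`.

All `--supports stmt-PneNP-18027`; no definitions.
-/

set_option linter.dupNamespace false -- `Summit.PneNP.PneNP.…`: summit = sub-problem (D-0017)

namespace Summit.PneNP.PneNP.Theorems

open Finset
open scoped ENNReal
open Literature.Computability.Complexity
open Literature.Probability.RandomGraphs.PlantedClique

variable {n : ℕ}

/-- A count inequality `#S ≤ a · #T + Σᵢ #Uᵢ` is a probability inequality under `G(n,1/2)`. [folklore] -/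
theorem erdosRenyiHalf_le_mul_add_sum_of_card_le {ι : Type*} (s : Finset ι) (S T : Set (EdgeVec n))
    (U : ι → Set (EdgeVec n)) [DecidablePred (· ∈ S)] [DecidablePred (· ∈ T)] [∀ i, DecidablePred (· ∈ U i)]
    (a : ℕ)
    (h : #(univ.filter fun x : EdgeVec n => x ∈ S) ≤
      a * #(univ.filter fun x : EdgeVec n => x ∈ T) + ∑ i ∈ s, #(univ.filter fun x : EdgeVec n => x ∈ U i)) :
    (erdosRenyiHalf n).toOuterMeasure S ≤
      (a : ℝ≥0∞) * (erdosRenyiHalf n).toOuterMeasure T + ∑ i ∈ s, (erdosRenyiHalf n).toOuterMeasure (U i) := by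
  simp only [erdosRenyiHalf_toOuterMeasure_eq_card_div]
  set K : ℝ≥0∞ := (Fintype.card (EdgeVec n) : ℝ≥0∞) with hK
  have hcast : ((#(univ.filter fun x : EdgeVec n => x ∈ S) : ℕ) : ℝ≥0∞) ≤
      (a : ℝ≥0∞) * ((#(univ.filter fun x : EdgeVec n => x ∈ T) : ℕ) : ℝ≥0∞) +
        ∑ i ∈ s, ((#(univ.filter fun x : EdgeVec n => x ∈ U i) : ℕ) : ℝ≥0∞) := by exact_mod_cast h
  calc ((#(univ.filter fun x : EdgeVec n => x ∈ S) : ℕ) : ℝ≥0∞) / K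
      ≤ ((a : ℝ≥0∞) * ((#(univ.filter fun x : EdgeVec n => x ∈ T) : ℕ) : ℝ≥0∞) +
          ∑ i ∈ s, ((#(univ.filter fun x : EdgeVec n => x ∈ U i) : ℕ) : ℝ≥0∞)) / K := ENNReal.div_le_div_right hcast K
    _ = (a : ℝ≥0∞) * (((#(univ.filter fun x : EdgeVec n => x ∈ T) : ℕ) : ℝ≥0∞) / K) +
          ∑ i ∈ s, ((#(univ.filter fun x : EdgeVec n => x ∈ U i) : ℕ) : ℝ≥0∞) / K := by
        simp only [div_eq_mul_inv]
        rw [add_mul, mul_assoc, Finset.sum_mul]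

open Classical in
/-- **Master inequality for ORs of CNFs under the planted-clique pair (per `n`).** With `r = C(v₀-1,2)`,
`t = (r+1) r`: under `m ≤ n^c`, `#(𝓒 i) ≤ n^c` and the numeric hypotheses `H1`–`H6` of `depth3_avg_H_le`,
`Pr_{G(n,1/2,k)}[∃ i, g_i] ≤ 2^t · Pr_{G(n,1/2)}[∃ i, g_i] + (2^{t+1} + 3) · (n²)⁻¹`. [folklore] -/
theorem depth3_planted_le (hn : 0 < n) (k : ℕ) {m : ℕ} (𝓒 : Fin m → Finset (Finset (⊤ : SimpleGraph (Fin n)).edgeSet))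
    {c L' v₀ M : ℕ} (hm : m ≤ n ^ c) (h𝓒 : ∀ i, #(𝓒 i) ≤ n ^ c) (hv₀ : 1 ≤ v₀) (hL' : 1 ≤ L')
    (H1 : n ^ (2 * c + 2) ≤ 2 ^ L') (H2 : M * M ≤ 2 * L') (H3 : 18 * (min k n * min k n) ≤ n)
    (H4 : (18 * (min k n * min k n)) ^ M * n ^ (2 * c + 2) ≤ n ^ M)
    (H5 : (4 * L' * min k n) ^ v₀ * n ^ (2 * c + 2) ≤ n ^ v₀) (H6 : 2 * (2 * L' * min k n) ≤ n) :
    (plantedCliqueDist n k).toOuterMeasure {x | ∃ i, ∀ S ∈ 𝓒 i, ∃ e ∈ S, x e = true} ≤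
      2 ^ (((v₀ - 1).choose 2 + 1) * ((v₀ - 1).choose 2)) *
          (erdosRenyiHalf n).toOuterMeasure {x | ∃ i, ∀ S ∈ 𝓒 i, ∃ e ∈ S, x e = true} +
        (2 ^ (((v₀ - 1).choose 2 + 1) * ((v₀ - 1).choose 2) + 1) + 3 : ℝ≥0∞) * (((n ^ 2 : ℕ) : ℝ≥0∞))⁻¹ := by
  classical
  set r := (v₀ - 1).choose 2 with hr
  set t := (r + 1) * r with ht
  set KS := kSubsets n k with hKS
  set P0 := erdosRenyiHalf n with hP0
  set μ := P0.toOuterMeasure {x | ∃ i, ∀ S ∈ 𝓒 i, ∃ e ∈ S, x e = true} with hμ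
  -- the `H_t` events
  set Hev : Fin m → Finset (Fin n) → Set (EdgeVec n) := fun i A => {x |
    (∀ S ∈ 𝓒 i, ∃ e ∈ S, plant A x e = true) ∧
      ∀ T : Finset (⊤ : SimpleGraph (Fin n)).edgeSet, (∀ S ∈ 𝓒 i, ∃ e ∈ S, e ∈ T) →
        (∀ e ∈ T, plant A x e = true) →
          t < #(T.filter fun e : (⊤ : SimpleGraph (Fin n)).edgeSet => ∀ v ∈ (e : Sym2 (Fin n)), v ∈ A)} with hHev
  have hne := card_kSubsets_cast_ne_zero n k
  have htop : ((#KS : ℕ) : ℝ≥0∞) ≠ ⊤ := ENNReal.natCast_ne_top _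
  -- per planted set
  have hA : ∀ A ∈ KS, P0.toOuterMeasure {x | plant A x ∈ {x : EdgeVec n | ∃ i, ∀ S ∈ 𝓒 i, ∃ e ∈ S, x e = true}} ≤
      2 ^ t * μ + ∑ i, P0.toOuterMeasure (Hev i A) := by
    intro A _
    have hcount := depth3_split_count A 𝓒 t
    have h := erdosRenyiHalf_le_mul_add_sum_of_card_le (univ : Finset (Fin m))
      {x | plant A x ∈ {x : EdgeVec n | ∃ i, ∀ S ∈ 𝓒 i, ∃ e ∈ S, x e = true}}
      {x : EdgeVec n | ∃ i, ∀ S ∈ 𝓒 i, ∃ e ∈ S, x e = true} (fun i => Hev i A) (2 ^ t)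
      (by simpa only [Set.mem_setOf_eq, hHev] using hcount)
    rw [hμ, hP0]
    convert h using 2
    push_cast
    rfl
  -- average over the planted set
  rw [plantedCliqueDist_toOuterMeasure_eq_sum]
  calc ((#KS : ℕ) : ℝ≥0∞)⁻¹ * ∑ A ∈ KS, P0.toOuterMeasure
          {x | plant A x ∈ {x : EdgeVec n | ∃ i, ∀ S ∈ 𝓒 i, ∃ e ∈ S, x e = true}}
      ≤ ((#KS : ℕ) : ℝ≥0∞)⁻¹ * ∑ A ∈ KS, (2 ^ t * μ + ∑ i, P0.toOuterMeasure (Hev i A)) := by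
        gcongr with A hAK; exact hA A hAK
    _ = 2 ^ t * μ + ∑ i, ((#KS : ℕ) : ℝ≥0∞)⁻¹ * ∑ A ∈ KS, P0.toOuterMeasure (Hev i A) := by
        rw [sum_add_distrib, sum_const, nsmul_eq_mul, mul_add, ← mul_assoc, ENNReal.inv_mul_cancel hne htop,
          one_mul, sum_comm, mul_sum]
    _ ≤ 2 ^ t * μ + ∑ _i : Fin m, (2 ^ ((r + 1) * r + 1) + 3 : ℝ≥0∞) * (((n ^ (c + 2) : ℕ) : ℝ≥0∞))⁻¹ := by
        refine add_le_add le_rfl (sum_le_sum fun i _ => ?_)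
        exact depth3_avg_H_le hn k (𝓒 i) (h𝓒 i) hv₀ hL' (Nat.lt_succ_self r) (by rw [ht, ← hr]; omega)
          H1 H2 H3 H4 H5 H6
    _ = 2 ^ t * μ + (m : ℝ≥0∞) * ((2 ^ ((r + 1) * r + 1) + 3 : ℝ≥0∞) * (((n ^ (c + 2) : ℕ) : ℝ≥0∞))⁻¹) := by
        rw [sum_const, card_univ, Fintype.card_fin, nsmul_eq_mul]
    _ ≤ 2 ^ t * μ + ((n ^ c : ℕ) : ℝ≥0∞) * ((2 ^ ((r + 1) * r + 1) + 3 : ℝ≥0∞) * (((n ^ (c + 2) : ℕ) : ℝ≥0∞))⁻¹) := by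
        gcongr
    _ = 2 ^ t * μ + (2 ^ ((r + 1) * r + 1) + 3 : ℝ≥0∞) * (((n ^ 2 : ℕ) : ℝ≥0∞))⁻¹ := by
        rw [mul_left_comm, natCast_pow_mul_inv_pow_add_two hn c]

/-! ### Registered form -/

/-- **stub_depth3Planted** (registered side result of stmt-PneNP-18027, depth-3 line of seat 0; NOT a stub of the
picked line's composition). [folklore] -/
theorem stub_depth3Planted : ∀ (n : ℕ), 0 < n → ∀ (k m : ℕ) (𝓒 : Fin m → Finset (Finset ((⊤ : SimpleGraph (Fin n)).edgeSet))) (c L' v₀ M : ℕ), m ≤ n ^ c → (∀ i, (𝓒 i).card ≤ n ^ c) → 1 ≤ v₀ → 1 ≤ L' → n ^ (2 * c + 2) ≤ 2 ^ L' → M * M ≤ 2 * L' → 18 * (min k n * min k n) ≤ n → (18 * (min k n * min k n)) ^ M * n ^ (2 * c + 2) ≤ n ^ M → (4 * L' * min k n) ^ v₀ * n ^ (2 * c + 2) ≤ n ^ v₀ → 2 * (2 * L' * min k n) ≤ n → (plantedCliqueDist n k).toOuterMeasure {x | ∃ i, ∀ S ∈ 𝓒 i, ∃ e ∈ S, x e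 = true} ≤ 2 ^ (((v₀ - 1).choose 2 + 1) * ((v₀ - 1).choose 2)) * (erdosRenyiHalf n).toOuterMeasure {x | ∃ i, ∀ S ∈ 𝓒 i, ∃ e ∈ S, x e = true} + (2 ^ (((v₀ - 1).choose 2 + 1) * ((v₀ - 1).choose 2) + 1) + 3 : ℝ≥0∞) * (((n ^ 2 : ℕ) : ℝ≥0∞))⁻¹ :=
  fun _ hn k _ 𝓒 _ _ _ _ hm h𝓒 hv₀ hL' H1 H2 H3 H4 H5 H6 =>
    depth3_planted_le hn k 𝓒 hm h𝓒 hv₀ hL' H1 H2 H3 H4 H5 H6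

end Summit.PneNP.PneNP.Theorems
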